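import Literature.NumberTheory.GaloisRepresentations.HomDualLocalPairing
import Literature.NumberTheory.GaloisRepresentations.ContinuousCohomologyBocksteinFunctorial
import HarnessLib

/-!
# (R4), native local half in GLOBAL terms: at a finite place the local Tate pairing of a local readout against
# `loc_v (H¹(ι) x)` is minus the Brauer invariant of `h_*(res_v (δ₁^K x))` — no biduality map left

Topic `NumberTheory/GaloisRepresentations`; namespace `Literature.NumberTheory.GaloisRepresentations.HomDual`.
Theorems only; no definition, no instance, no named fact, no `sorry`.  Sequel to `HomDualLocalPairing` (door-c6 g17:
`zmodToQmodZ_localTatePairingZMod_localReadout`, the local dictionary with a local class `y ∈ H¹(K_v, M^{DD})` and an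
inverse-of-biduality `κ`) and `ContinuousCohomologyBocksteinFunctorial` (`IsSES.pullH_δ₁`: connecting maps commute with
restriction of the group).

For the canonical presentation `0 → N₁ → P → M → 0` of a finite `n`-torsion Galois module `ρ` over a number field `K`
(`FreePresentation.presentationComplex ρ`; native `IsSES`, `FreePresentation.pres_isSES`):
* **`res_δ₁_presentation`** — `res_{K'}(δ₁^K x) = δ₁^{K'}(res_{K'} x)` for every extension field `K'/K`: the native
  connecting map `δ₁ : H¹(·, M) → H²(·, N₁)` of the presentation commutes with restriction (`IsSES.pullH_δ₁`, the
  restricted sequence being `HomDual.isSES_restrict` DEFINITIONALLY).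
* **`map_map_res_eq_res`** — `H¹(κ)(res (H¹(ι) x)) = res x` for `κ ∘ ι = id`.
* **`zmodToQmodZ_localTatePairingZMod_localReadout_global`** — for `x ∈ H¹(K, M)` GLOBAL, a biduality pair
  `ι : M → M^{DD}`, `κ : M^{DD} → M` (`κ ∘ ι = id`, `Φ f = f (κ Φ)`), a finite place `v` and a `Γ_{K_v}`-equivariant
  `h : N₁ → K̄_vˣ`:  `(1/n)·⟨localReadout h, loc_v (H¹(ι) x)⟩_v = − inv_{K_v}( h_*( res_v (δ₁^K x) ) )`.
  This is the form the E-side of (R4) produces (a global class `x`, the GLOBAL native connecting map of the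
  presentation, then restriction to `K_v` and push-forward along the local readout map `h = π_v ∘ f`).
HONEST FRAMING: no case of Poitou–Tate or BSD is proved here; the archimedean places are not treated.

## References
* J. S. Milne, *Arithmetic Duality Theorems* (2nd ed. 2006), I Thm. 4.10 (proof, p. 58), Prop. 0.19. [MilneADT2006]
* J.-P. Serre, *Galois Cohomology* (1997), I §2.2–§2.4. [SerreGaloisCohomology1997]
* J. Neukirch, A. Schmidt, K. Wingberg, *Cohomology of Number Fields* (2008), (1.4.2)–(1.5.2). [NeukirchSchmidtWingberg2008]
-/

noncomputable section

open CategoryTheory NumberField IsDedekindDomain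
open Field (absoluteGaloisGroup)
open scoped ContRepresentation

namespace Literature.NumberTheory.GaloisRepresentations

namespace HomDual

open Literature.Algebra.Homology Literature.Algebra.Homology.DiscreteRep DiscreteGaloisModule
  FreePresentation DGMBridge Literature.NumberTheory.GaloisCohomology
  Literature.AnabelianGeometry.AbsoluteAnabelian.Prop121vii

-- explicit cocycles / `δ₁` need `LocallyCompactSpace Γ`; the tree's `absoluteGaloisGroup_compactSpace` is the source.
attribute [local instance] absoluteGaloisGroup_compactSpace

variable {K : Type} [Field K] [NumberField K]
variable {M : Type} [AddCommGroup M] [TopologicalSpace M] [DiscreteTopology M] [Finite M]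
variable (ρ : DiscreteGaloisModule K M) (n : ℕ) [NeZero n]

/-- **`res_{K'} ∘ δ₁^K = δ₁^{K'} ∘ res_{K'}`** for the canonical presentation of `ρ` (the native connecting map
commutes with restriction of the field; the restricted presentation is `isSES_restrict … (pres_isSES ρ)`).
[cite: SerreGaloisCohomology1997, I §2.4][cite: NeukirchSchmidtWingberg2008, (1.5.2)] -/
theorem res_δ₁_presentation (K' : Type) [Field K'] [Algebra K K'] (x : galoisCohomology ρ 1) :
    galoisCohomology.res (presModule₁ ρ) K' 2 ((pres_isSES ρ).δ₁ x) =
      (isSES_restrict (presModule₁ ρ) (presModule₂ ρ) ρ (pres_isSES ρ) (K' := K')).δ₁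
        (galoisCohomology.res ρ K' 1 x) :=
  (pres_isSES ρ).pullH_δ₁ (absGaloisRestrict K K') x

omit [NumberField K] [Finite M] in
/-- **`H¹(κ)(res (H¹(ι) x)) = res x`** for continuous equivariant `ι : M → M'`, `κ : M' → M` with `κ ∘ ι = id`.
[cite: SerreGaloisCohomology1997, I §2.2, §2.4] -/
theorem map_map_res_eq_res {M' : Type} [AddCommGroup M'] [TopologicalSpace M'] [DiscreteTopology M']
    {ρ' : DiscreteGaloisModule K M'} (ι : ρ.toContRepresentation →ⁱL ρ'.toContRepresentation)
    (κ : ρ'.toContRepresentation →ⁱL ρ.toContRepresentation) (hκι : ∀ m : M, κ (ι m) = m)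
    (K' : Type) [Field K'] [Algebra K K'] (x : galoisCohomology ρ 1) :
    galoisCohomology.map (κ.restrictField K') 1 (galoisCohomology.res ρ' K' 1 (galoisCohomology.map ι 1 x)) =
      galoisCohomology.res ρ K' 1 x := by
  rw [← galoisCohomology.res_map_one]
  congr 1
  obtain ⟨φ, rfl⟩ := oneCocycleClass_surjective _ x
  rw [galoisCohomology.map_one_oneCocycleClass, galoisCohomology.map_one_oneCocycleClass]
  exact congrArg (oneCocycleClass _) (Subtype.ext (ContinuousMap.ext fun σ => hκι (φ.1 σ)))

/-- **(R4), native local half in global terms.**  For `x ∈ H¹(K, M)`, a biduality pair `(ι, κ)` (`κ ∘ ι = id`,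
`Φ f = f (κ Φ)`), a finite place `v` and a `Γ_{K_v}`-equivariant `h : N₁ → K̄_vˣ` out of the relation module of the
canonical presentation of `ρ`:
`zmodToQmodZ n ⟨localReadout h, loc_v (H¹(ι) x)⟩_v = − brauerInvariantEquiv K_v (h_* (res_v (δ₁^K x)))`.
[cite: MilneADT2006, I Thm. 4.10 (proof, p. 58), Prop. 0.19][cite: NeukirchSchmidtWingberg2008, (1.4.2)–(1.5.2)] -/
theorem zmodToQmodZ_localTatePairingZMod_localReadout_global [Finite (TateDual K M n)]
    (hM : ∀ m : M, n • m = 0) (v : HeightOneSpectrum (𝓞 K)) [CharZero (v.adicCompletion K)]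
    (ι : ρ.toContRepresentation →ⁱL ((ρ.tateDual n).tateDual n).toContRepresentation)
    (κ : ((ρ.tateDual n).tateDual n).toContRepresentation →ⁱL ρ.toContRepresentation)
    (hκι : ∀ m : M, κ (ι m) = m)
    (hκ : ∀ (Φ : TateDual K (TateDual K M n) n) (f : TateDual K M n), Φ f = f (κ Φ))
    (h : (haveI := moduleFinite_presModule₁ ρ
      (homGaloisModule ((presModule₁ ρ).restrictField (v.adicCompletion K)) (units (v.adicCompletion K))).toTopRep.ρ.invariants))
    (x : galoisCohomology ρ 1) :
    zmodToQmodZ n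
        (localTatePairingZMod (ρ.tateDual n) n (Sum.inr v) (LocalInvariants.canonical K n (Sum.inr v))
          (localReadout ρ n hM (v.adicCompletion K) h)
          (galoisCohomology.res ((ρ.tateDual n).tateDual n) (v.adicCompletion K) 1 (galoisCohomology.map ι 1 x))) =
      - brauerInvariantEquiv (v.adicCompletion K)
          (haveI := moduleFinite_presModule₁ ρ
           cohomologyMap (toTopRepHom ((presModule₁ ρ).restrictField (v.adicCompletion K)) (units (v.adicCompletion K))
              (equivariantMap ((presModule₁ ρ).restrictField (v.adicCompletion K)) (units (v.adicCompletion K)) h)) 2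
            (galoisCohomology.res (presModule₁ ρ) (v.adicCompletion K) 2 ((pres_isSES ρ).δ₁ x))) := by
  haveI := moduleFinite_presModule₁ ρ
  haveI := moduleFinite_presModule₂ ρ
  rw [zmodToQmodZ_localTatePairingZMod_localReadout ρ n hM v κ hκ h, map_map_res_eq_res ρ ι κ hκι,
    res_δ₁_presentation ρ (v.adicCompletion K) x]

end HomDual

end Literature.NumberTheory.GaloisRepresentations

end
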